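import Summits.Schanuel.Schanuel.Theorems.ZilberEacCyclicCoverSheetFibres
import HarnessLib

/-!
# Arbitrary base branches, LVII: RATIONAL fibres over `x₁² = P(x₀)` off the residue class
# `deg P ≡ 2 (mod 4)` — every nonzero rational function on the curve

HONEST FRAMING.  Cell `pub-schanuel` (Zilber's Exponential-Algebraic Closedness, case ladder;
host summit Schanuel), seat 2, gen 30.  Over `C : x₁² = P(x₀)` (`P` monic of degree `M ≥ 1` with a
simple root) the principal sheet `x₀ = s^{-2}`, `x₁ = Φ(s)s^{-M}`, `Φ(0) = 1`, has a good direction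
exactly off the residue class `M ≡ 2 (mod 4)` (file XX), and then the pole-fibre engine of file
XXXII accepts EVERY order `L ∈ ℤ`.  With the meromorphic normal form of file LIII (b) (Bézout) for
numerator and denominator this gives **`unprojectedDense_hyperelliptic_rationalFibre`**: for
`M % 4 ≠ 2` and `R, Q ∈ ℂ[x₀, x₁]` each nonzero somewhere on `C`, every irreducible surface `S` of
dimension `≤ 2` containing the graph of `R/Q` over `C` (off the poles) has Zariski-dense exponential
points — the graph of EVERY `f ∈ ℂ(C)^×` over every hyperelliptic curve of odd degree, of degree
`≡ 0 (mod 4)`, and over `x₁² = x₀ + c`.  (`M ≡ 2 (mod 4)`: polynomial fibres are file LI; a rational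
`f` finite and nonzero at both places at infinity is OPEN, O86.)  Decided instances of an OPEN
question (Mantova–Masser, PLMS 2024 §1 p. 5); EC(3,2) OPEN; NOT Schanuel's conjecture (neither used
nor implied); EAC ⇏ SC.
-/

noncomputable section

open Filter Topology Set Complex Polynomial
open Literature.NumberTheory.Transcendental Literature.ModelTheory.Zilber
open Literature.ModelTheory.ExponentialFields

set_option linter.dupNamespace false

namespace Summit.Schanuel.Schanuel.Theorems

section Hyperelliptic

variable (P : ℂ[X])

/-- **Rational fibres over `x₁² = P(x₀)`, `deg P ≢ 2 (mod 4)`: dense.**  `P` monic of degree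
`M ≥ 1`, `M % 4 ≠ 2`, with a simple root; `R, Q ∈ ℂ[x₀, x₁]` each nonzero somewhere on the curve;
`S` irreducible closed of dimension `≤ 2` containing every point `(x₀, x₁, R/Q, e^{x₁})` of the graph
off the poles.  Then `S` has Zariski-dense exponential points (principal sheet, off the residue
class, any order). [cite: MantovaMasser2023, §1 Further remarks, p. 5 (the question, open in
general)] (new) -/
theorem unprojectedDense_hyperelliptic_rationalFibre (hP : P.Monic) (hM : 1 ≤ P.natDegree)
    (hres : P.natDegree % 4 ≠ 2) {r : ℂ} (hr : P.IsRoot r) (hr1 : P.derivative.eval r ≠ 0)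
    (R Q : MvPolynomial (Fin 2) ℂ)
    (hR : ∃ x : Fin 2 → ℂ, MvPolynomial.eval x
        (MvPolynomial.X 1 ^ 2 - Polynomial.aeval (MvPolynomial.X 0 : MvPolynomial (Fin 2) ℂ) P) = 0 ∧
      MvPolynomial.eval x R ≠ 0)
    (hQ : ∃ x : Fin 2 → ℂ, MvPolynomial.eval x
        (MvPolynomial.X 1 ^ 2 - Polynomial.aeval (MvPolynomial.X 0 : MvPolynomial (Fin 2) ℂ) P) = 0 ∧
      MvPolynomial.eval x Q ≠ 0)
    {S : Set (Fin 2 ⊕ Fin 2 → ℂ)} (hS : IsIrreducibleClosed ℂ S) (hdim : zariskiDim ℂ S ≤ (2 : ℕ))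
    (hsub : ∀ x y : ℂ, y ^ 2 = P.eval x → MvPolynomial.eval ![x, y] Q ≠ 0 →
      (Sum.elim ![x, y] ![MvPolynomial.eval ![x, y] R / MvPolynomial.eval ![x, y] Q, Complex.exp y] :
        Fin 2 ⊕ Fin 2 → ℂ) ∈ S) :
    UnprojectedDense S := by
  classical
  set M : ℕ := P.natDegree with hMdef
  have hk1 : 1 ≤ 2 := by norm_num
  obtain ⟨GR, hGRdeg, hGRev⟩ := exists_rows_reduction P hk1 R
  obtain ⟨GQ, hGQdeg, hGQev⟩ := exists_rows_reduction P hk1 Q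
  have hpt_rows : ∀ {G : ℂ[X][X]} {T : MvPolynomial (Fin 2) ℂ},
      (∀ x y : ℂ, y ^ 2 = P.eval x →
        MvPolynomial.eval ![x, y] T = (G.map (Polynomial.evalRingHom x)).eval y) →
      (∃ x : Fin 2 → ℂ, MvPolynomial.eval x
        (MvPolynomial.X 1 ^ 2 - Polynomial.aeval (MvPolynomial.X 0 : MvPolynomial (Fin 2) ℂ) P) = 0 ∧
        MvPolynomial.eval x T ≠ 0) → G ≠ 0 := by
    intro G T hGev hT hG
    obtain ⟨x, hxC, hxT⟩ := hT
    apply hxT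
    have hy : x 1 ^ 2 = P.eval (x 0) := by
      rw [eval_superellipticMv] at hxC
      exact sub_eq_zero.1 hxC
    have hx : x = ![x 0, x 1] := by
      funext i
      fin_cases i <;> simp
    rw [hx, hGev _ _ hy, hG, Polynomial.map_zero, Polynomial.eval_zero]
  have hGR0 : GR ≠ 0 := hpt_rows hGRev hR
  have hGQ0 : GQ ≠ 0 := hpt_rows hGQev hQ
  obtain ⟨Φ, hΦan, hΦ0, hsheet⟩ := superelliptic_sheet_facts P hk1 hP (one_pow 2)
  obtain ⟨ψR, LR, hψRan, hψR0, hfR⟩ :=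
    exists_cyclicSheet_normalForm P hk1 hr hr1 GR hGR0 hGRdeg hΦan hsheet
  obtain ⟨ψQ, LQ, hψQan, hψQ0, hfQ⟩ :=
    exists_cyclicSheet_normalForm P hk1 hr hr1 GQ hGQ0 hGQdeg hΦan hsheet
  set ψ : ℂ → ℂ := fun s => ψR s / ψQ s with hψ
  have hψan : AnalyticAt ℂ ψ 0 := hψRan.div hψQan hψQ0
  have hψ0 : ψ 0 ≠ 0 := div_ne_zero hψR0 hψQ0
  have hψQne : ∀ᶠ s in 𝓝 (0 : ℂ), ψQ s ≠ 0 := hψQan.continuousAt.eventually_ne hψQ0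
  have hres' : ¬ (2 ∣ 2 * M ∧ (2 * M / 2) % 4 = 2) := by
    rintro ⟨-, h⟩
    rw [Nat.mul_div_cancel_left _ (by norm_num : 0 < 2)] at h
    exact hres h
  refine unprojectedDense_branch_poleFibre_of_not_residue hS hdim hk1 hM hres' (LR - LQ) hψan hψ0 hΦan
    hΦ0 ?_
  filter_upwards [hsheet, hfR, hfQ, eventually_nhdsWithin_of_eventually_nhds hψQne, self_mem_nhdsWithin]
    with s hs hRs hQs hψQs hs0
  have hs0' : s ≠ 0 := hs0
  have hy : (Φ s * (s ^ M)⁻¹) ^ 2 = P.eval (s ^ 2)⁻¹ := sub_eq_zero.1 hs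
  have hQne : MvPolynomial.eval ![(s ^ 2)⁻¹, Φ s * (s ^ M)⁻¹] Q ≠ 0 := by
    rw [hGQev _ _ hy, hQs]
    exact mul_ne_zero hψQs (zpow_ne_zero _ hs0')
  have hpt := hsub _ _ hy hQne
  have hval : MvPolynomial.eval ![(s ^ 2)⁻¹, Φ s * (s ^ M)⁻¹] R /
      MvPolynomial.eval ![(s ^ 2)⁻¹, Φ s * (s ^ M)⁻¹] Q = ψ s * s ^ (LR - LQ) := by
    rw [hGRev _ _ hy, hGQev _ _ hy, hRs, hQs, hψ, zpow_sub₀ hs0']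
    simp only
    field_simp
  rw [hval] at hpt
  exact hpt

/-- **Rational fibres over the hyperelliptic curves of ODD degree** (every genus; `P` monic of odd
degree with a simple root): every irreducible `S ⊇` the graph of `R/Q` is dense.
[cite: MantovaMasser2023, §1 Further remarks, p. 5 (the question, open in general)] (new) -/
theorem unprojectedDense_hyperellipticOdd_rationalFibre (hP : P.Monic) (hodd : Odd P.natDegree)
    {r : ℂ} (hr : P.IsRoot r) (hr1 : P.derivative.eval r ≠ 0) (R Q : MvPolynomial (Fin 2) ℂ)
    (hR : ∃ x : Fin 2 → ℂ, MvPolynomial.eval x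
        (MvPolynomial.X 1 ^ 2 - Polynomial.aeval (MvPolynomial.X 0 : MvPolynomial (Fin 2) ℂ) P) = 0 ∧
      MvPolynomial.eval x R ≠ 0)
    (hQ : ∃ x : Fin 2 → ℂ, MvPolynomial.eval x
        (MvPolynomial.X 1 ^ 2 - Polynomial.aeval (MvPolynomial.X 0 : MvPolynomial (Fin 2) ℂ) P) = 0 ∧
      MvPolynomial.eval x Q ≠ 0)
    {S : Set (Fin 2 ⊕ Fin 2 → ℂ)} (hS : IsIrreducibleClosed ℂ S) (hdim : zariskiDim ℂ S ≤ (2 : ℕ))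
    (hsub : ∀ x y : ℂ, y ^ 2 = P.eval x → MvPolynomial.eval ![x, y] Q ≠ 0 →
      (Sum.elim ![x, y] ![MvPolynomial.eval ![x, y] R / MvPolynomial.eval ![x, y] Q, Complex.exp y] :
        Fin 2 ⊕ Fin 2 → ℂ) ∈ S) :
    UnprojectedDense S := by
  obtain ⟨j, hj⟩ := hodd
  exact unprojectedDense_hyperelliptic_rationalFibre P hP (by omega) (by omega) hr hr1 R Q hR hQ hS hdim
    hsub

end Hyperelliptic

end Summit.Schanuel.Schanuel.Theorems

end
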